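import Summits.QuantumFields.QCD.Theses.HeatSlicedQuarks
import Literature.MathematicalPhysics.QuantumLattice.OverlapLocality
import Literature.MathematicalPhysics.QuantumLattice.LatticeToriProofs
import Literature.MathematicalPhysics.QuantumLattice.LinkHopCommutators
import Literature.MathematicalPhysics.QuantumLattice.WilsonDiracLowerBound
import Literature.Analysis.Matrix.AgmonDecayBelowLocalFloor

/-!
# Stub `stub_lowModesHugRoughness` of line `low-mode-quarantine`
(crux `Summit.QuantumFields.QCD.Theses.HeatSlicedQuarks.RobustYangMillsHandover`,
item stmt-QuantumFields-8892)

**Sub-threshold modes hug the rough plaquettes (lattice Agmon estimate).**  For every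
`m₀ ∈ (0, 1]` there are `ε₀, c, C > 0` depending on `m₀` only (here `ε₀ = 9m₀⁴/125000`,
`c = 2 log(1 + m₀/960)`, `C` explicit below) such that on every periodic lattice `(ℤ/L)⁴`, for
every `SU(3)` gauge field `U`, every mass `m ∈ [−1/2, 1]` with `|m| ≥ m₀`, every eigenvector
`H v = e v` of `H = D_Wᴴ D_W` (`D_W = wilsonDirac (fundamentalRep (Fin 3)) U m 1`) with
`0 ≤ e ≤ m₀²/4`, and every site `x` at torus distance `≥ n` from every site carrying an
`ε₀`-ROUGH plaquette (`3 − Re tr U_p ≥ ε₀`):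
`Σ_{a,α} |v(x,a,α)|² ≤ C e^{−c n} Σ_i |v_i|²`.

Proof (Agmon's method below a LOCAL floor, abstract engine
`Literature.Analysis.Matrix.norm_sq_le_of_eigenvector_of_localFloor`):
* `D_W` has RANGE ONE in the sites and off-site absolute row/column sums `≤ h = 96`
  (`lhr_wilsonDirac_range`, `lhr_wilsonDirac_rowSum_le`, `lhr_wilsonDirac_colSum_le`, copies of
  the private helpers of the sibling stub `stub_highBlockLocality`), and `‖H‖ ≤ ‖D_W‖² ≤ 81`
  (`l2_opNorm_wilsonDirac_le`), so `Σ|(Hw)_i|² ≤ 81² Σ|w_i|²` (`lhr_sum_norm_sq_H_mulVec_le`).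
* LOCAL FLOOR (Neuberger's local lower bound `wilsonDirac_normSq_mulVec_ge_of_plaquette_near_support`
  [Neuberger2000Bounds] + `norm_one_sub_le_sqrt_two_mul_trace_deficit`, both signs of `m`,
  `lhr_localFloor`): a field supported at torus distance `≥ 2` from the rough sites sees only
  plaquettes of deficit `< ε₀` within distance `1` of its support, hence
  `‖D_W w‖² ≥ (m₀² − 30√(2ε₀))‖w‖² = (16m₀²/25)‖w‖²` (`√(2ε₀) = 3m₀²/250`).
* DISTANCE TO THE ROUGH SET `dR` (`= n` if there is no rough site): `1`-Lipschitz for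
  `torusDist`, `≤ torusDist(·, y)` for rough `y`, and `dR(x) ≥ n` by hypothesis.
* NUMBERS: rate `θ = log(1 + m₀/960)`, so `η = 96(e^θ − 1) = m₀/10`; with `√F = 4m₀/5` and
  `e ≤ m₀²/4`, `t² − 2ηt − η² − e ≥ 12m₀²/25 − m₀²/100 − m₀²/4 ≥ m₀²/5 =: γ` for `t ≥ √F`.
* The abstract estimate gives `|v_k|² ≤ C₀ e^{−2θ dR(k)} Σ|v|²` for every index `k`, with
  `C₀ = e^{6θ}((2·81² + 2e²)/γ² + 1) ≤ e^{6θ}((2·81² + 2(m₀²/4)²)/γ² + 1)`; summing the `12`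
  colour–spin components at `x` and using `dR(x) ≥ n` gives the claim with `c = 2θ`, `C = 12 C₀`.
No separate treatment of the trivial regimes (no rough plaquette; `m ≥ m₀`; small `n`) is needed.
References: S. Agmon (1982); Combes–Thomas [CombesThomas1973]; Aizenman–Warzel GSM 168 §10.3
[AizenmanWarzel2015]; Neuberger, Phys. Rev. D 61 (2000) 085015 [Neuberger2000Bounds].
-/

namespace Summit.QuantumFields.QCD.Cruxes.RobustYangMillsHandover.LowModeQuarantine

open scoped BigOperators Classical Matrix
open Literature.MathematicalPhysics.QuantumFieldTheory
open Literature.MathematicalPhysics.QuantumLattice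
open Literature.Probability.LatticeModels (TorusSite)
open Filter Topology

/-- Entries of the (unitary) Euclidean gamma matrices have modulus `≤ 1`.  (Copy of the private
`hbl_norm_euclideanGamma_apply_le` of the sibling stub `stub_highBlockLocality`.) -/
private theorem lhr_norm_euclideanGamma_apply_le (μ : Fin 4) (α β : Fin 4) :
    ‖euclideanGamma μ α β‖ ≤ 1 := by
  refine entry_norm_bound_of_unitary (Matrix.mem_unitaryGroup_iff'.mpr ?_) α β
  rw [Matrix.star_eq_conjTranspose, (euclideanGamma_isHermitian μ).eq, euclideanGamma_mul_self]

/-- Entries of `r·1 ∓ γ_μ` at `r = 1` have modulus `≤ 2`.  (Copy of the private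
`hbl_norm_one_sub_gamma_apply_le`.) -/
private theorem lhr_norm_one_sub_gamma_apply_le (μ : Fin 4) (α β : Fin 4) :
    ‖(((1 : ℝ) : ℂ) • (1 : Matrix (Fin 4) (Fin 4) ℂ) - euclideanGamma μ) α β‖ ≤ 2 ∧
      ‖(((1 : ℝ) : ℂ) • (1 : Matrix (Fin 4) (Fin 4) ℂ) + euclideanGamma μ) α β‖ ≤ 2 := by
  have h1 : ‖(1 : Matrix (Fin 4) (Fin 4) ℂ) α β‖ ≤ 1 := by
    rw [Matrix.one_apply]; split_ifs <;> simp
  have h2 := lhr_norm_euclideanGamma_apply_le μ α β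
  simp only [Complex.ofReal_one, one_smul, Matrix.sub_apply, Matrix.add_apply]
  exact ⟨(norm_sub_le _ _).trans (by linarith), (norm_add_le _ _).trans (by linarith)⟩

variable {L : ℕ} [NeZero L]

omit [NeZero L] in
/-- Off the diagonal, `|D_{pq}| ≤ Σ_μ (𝟙[q = p + μ̂] + 𝟙[p = q + μ̂])` (site components; one
forward and one backward hop per direction, each of modulus `≤ ½ · 2 · 1`).  (Copy of the
private `hbl_norm_wilsonDirac_apply_le`.) -/
private theorem lhr_norm_wilsonDirac_apply_le
    (U : GaugeConfig 4 L ↥(Matrix.specialUnitaryGroup (Fin 3) ℂ)) (m : ℝ)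
    {p q : TorusSite 4 L × Fin 3 × Fin 4} (hpq : p ≠ q) :
    ‖wilsonDirac (fundamentalRep (Fin 3)) U m 1 p q‖ ≤
      ∑ μ : Fin 4, ((if q.1 = Site.shift p.1 μ then (1 : ℝ) else 0) +
        (if p.1 = Site.shift q.1 μ then (1 : ℝ) else 0)) := by
  have hU : ∀ g : ↥(Matrix.specialUnitaryGroup (Fin 3) ℂ), ∀ a b : Fin 3,
      ‖fundamentalRep (Fin 3) g a b‖ ≤ 1 := fun g a b =>
    entry_norm_bound_of_unitary (fundamentalRep_mem_unitaryGroup g) a b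
  simp only [wilsonDirac, Matrix.of_apply, if_neg hpq, zero_sub, norm_neg, norm_mul]
  have hhalf : ‖(1 / 2 : ℂ)‖ = 1 / 2 := by norm_num
  rw [hhalf]
  have hterm : ∀ μ : Fin 4,
      ‖(if q.1 = Site.shift p.1 μ then
            (((1 : ℝ) : ℂ) • (1 : Matrix (Fin 4) (Fin 4) ℂ) - euclideanGamma μ) p.2.2 q.2.2 *
              fundamentalRep (Fin 3) (U (p.1, μ)) p.2.1 q.2.1 else 0) +
          (if p.1 = Site.shift q.1 μ then
            (((1 : ℝ) : ℂ) • (1 : Matrix (Fin 4) (Fin 4) ℂ) + euclideanGamma μ) p.2.2 q.2.2 *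
              fundamentalRep (Fin 3) (U (q.1, μ))⁻¹ p.2.1 q.2.1 else 0)‖ ≤
        2 * ((if q.1 = Site.shift p.1 μ then (1 : ℝ) else 0) +
          (if p.1 = Site.shift q.1 μ then (1 : ℝ) else 0)) := by
    intro μ
    obtain ⟨hm, hp⟩ := lhr_norm_one_sub_gamma_apply_le μ p.2.2 q.2.2
    refine (norm_add_le _ _).trans ?_
    rw [mul_add]
    refine add_le_add ?_ ?_
    · split_ifs with hc
      · rw [norm_mul]
        calc _ ≤ 2 * 1 := mul_le_mul hm (hU _ _ _) (norm_nonneg _) zero_le_two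
          _ = 2 * 1 := rfl
      · simp
    · split_ifs with hc
      · rw [norm_mul]
        calc _ ≤ 2 * 1 := mul_le_mul hp (hU _ _ _) (norm_nonneg _) zero_le_two
          _ = 2 * 1 := rfl
      · simp
  calc 1 / 2 * ‖∑ μ : Fin 4, _‖ ≤ 1 / 2 * ∑ μ : Fin 4,
        2 * ((if q.1 = Site.shift p.1 μ then (1 : ℝ) else 0) +
          (if p.1 = Site.shift q.1 μ then (1 : ℝ) else 0)) := by
        refine mul_le_mul_of_nonneg_left
          ((norm_sum_le _ _).trans (Finset.sum_le_sum fun μ _ => hterm μ)) ?_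
        norm_num
    _ = _ := by rw [← Finset.mul_sum]; ring

/-- **Range one**: `D_{pq} ≠ 0` forces `torusDist p q ≤ 1` (site components).  (Copy of the
private `hbl_wilsonDirac_range`.) -/
private theorem lhr_wilsonDirac_range
    (U : GaugeConfig 4 L ↥(Matrix.specialUnitaryGroup (Fin 3) ℂ)) (m : ℝ)
    (p q : TorusSite 4 L × Fin 3 × Fin 4)
    (h : wilsonDirac (fundamentalRep (Fin 3)) U m 1 p q ≠ 0) : torusDist p.1 q.1 ≤ 1 := by
  by_contra hd
  rw [not_le] at hd
  have hpq : p ≠ q := by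
    rintro rfl
    rw [torusDist_self] at hd
    exact Nat.not_succ_le_zero 1 hd
  have h1 : ∀ μ : Fin 4, ¬ q.1 = Site.shift p.1 μ := by
    intro μ hq
    have := torusDist_add_single_le_one p.1 μ
    rw [torusDist_comm', ← Site.shift, ← hq] at this
    omega
  have h2 : ∀ μ : Fin 4, ¬ p.1 = Site.shift q.1 μ := by
    intro μ hp
    have := torusDist_add_single_le_one q.1 μ
    rw [← Site.shift, ← hp] at this
    omega
  have hle := lhr_norm_wilsonDirac_apply_le U m hpq
  simp only [if_neg (h1 _), if_neg (h2 _), add_zero, Finset.sum_const_zero] at hle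
  exact h (norm_le_zero_iff.mp hle)

/-- Counting: `#{(y, b, β) | y = s} = 12`.  (Copy of the private `hbl_sum_ite_fst_eq`.) -/
private theorem lhr_sum_ite_fst_eq (s : TorusSite 4 L) :
    ∑ q : TorusSite 4 L × Fin 3 × Fin 4, (if q.1 = s then (1 : ℝ) else 0) = 12 := by
  rw [Fintype.sum_prod_type, Finset.sum_eq_single s (fun y _ hy => by simp [hy]) (by simp)]
  simp only [if_true, Finset.sum_const, Finset.card_univ, Fintype.card_prod, Fintype.card_fin,
    nsmul_eq_mul, mul_one]
  norm_num

/-- Counting the hops at a site: `Σ_q Σ_μ (𝟙[q = s + μ̂] + 𝟙[s = q + μ̂]) = 96` (copy of the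
private `lmb_sum_hops_eq` of the sibling stub `stub_localModeBudget`). -/
private theorem lhr_sum_hops_eq (s : TorusSite 4 L) :
    ∑ q : TorusSite 4 L × Fin 3 × Fin 4, ∑ μ : Fin 4,
      ((if q.1 = Site.shift s μ then (1 : ℝ) else 0) +
        (if s = Site.shift q.1 μ then (1 : ℝ) else 0)) = 96 := by
  rw [Finset.sum_comm]
  calc _ = ∑ _μ : Fin 4, ((12 : ℝ) + 12) := by
        refine Finset.sum_congr rfl fun μ _ => ?_
        rw [Finset.sum_add_distrib, lhr_sum_ite_fst_eq]
        simp_rw [eq_shift_iff s _ μ]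
        rw [lhr_sum_ite_fst_eq]
    _ = 96 := by norm_num

/-- **Row sums**: `Σ_{q : dist(p,q) ≠ 0} |D_{pq}| ≤ 96`.  (Copy of the private
`lmb_wilsonDirac_rowSum_le`.) -/
private theorem lhr_wilsonDirac_rowSum_le
    (U : GaugeConfig 4 L ↥(Matrix.specialUnitaryGroup (Fin 3) ℂ)) (m : ℝ)
    (p : TorusSite 4 L × Fin 3 × Fin 4) :
    ∑ q ∈ Finset.univ.filter (fun q : TorusSite 4 L × Fin 3 × Fin 4 => torusDist p.1 q.1 ≠ 0),
      ‖wilsonDirac (fundamentalRep (Fin 3)) U m 1 p q‖ ≤ 96 := by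
  calc _ ≤ ∑ q ∈ Finset.univ.filter
          (fun q : TorusSite 4 L × Fin 3 × Fin 4 => torusDist p.1 q.1 ≠ 0),
        ∑ μ : Fin 4, ((if q.1 = Site.shift p.1 μ then (1 : ℝ) else 0) +
          (if p.1 = Site.shift q.1 μ then (1 : ℝ) else 0)) := by
        refine Finset.sum_le_sum fun q hq => lhr_norm_wilsonDirac_apply_le U m ?_
        rintro rfl
        rw [Finset.mem_filter, torusDist_self] at hq
        exact hq.2 rfl
    _ ≤ _ := Finset.sum_le_univ_sum_of_nonneg fun q => Finset.sum_nonneg fun μ _ => by positivity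
    _ = 96 := lhr_sum_hops_eq p.1

/-- **Column sums**: `Σ_{p : dist(p,q) ≠ 0} |D_{pq}| ≤ 96`.  (Copy of the private
`lmb_wilsonDirac_colSum_le`.) -/
private theorem lhr_wilsonDirac_colSum_le
    (U : GaugeConfig 4 L ↥(Matrix.specialUnitaryGroup (Fin 3) ℂ)) (m : ℝ)
    (q : TorusSite 4 L × Fin 3 × Fin 4) :
    ∑ p ∈ Finset.univ.filter (fun p : TorusSite 4 L × Fin 3 × Fin 4 => torusDist p.1 q.1 ≠ 0),
      ‖wilsonDirac (fundamentalRep (Fin 3)) U m 1 p q‖ ≤ 96 := by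
  calc _ ≤ ∑ p ∈ Finset.univ.filter
          (fun p : TorusSite 4 L × Fin 3 × Fin 4 => torusDist p.1 q.1 ≠ 0),
        ∑ μ : Fin 4, ((if p.1 = Site.shift q.1 μ then (1 : ℝ) else 0) +
          (if q.1 = Site.shift p.1 μ then (1 : ℝ) else 0)) := by
        refine Finset.sum_le_sum fun p hp => (lhr_norm_wilsonDirac_apply_le U m ?_).trans
          (le_of_eq (Finset.sum_congr rfl fun μ _ => add_comm _ _))
        rintro rfl
        rw [Finset.mem_filter, torusDist_self] at hp
        exact hp.2 rfl
    _ ≤ _ := Finset.sum_le_univ_sum_of_nonneg fun p => Finset.sum_nonneg fun μ _ => by positivity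
    _ = 96 := lhr_sum_hops_eq q.1

open scoped Matrix.Norms.L2Operator in
/-- **Crude size bound** `Σ_i |(D_Wᴴ D_W w)_i|² ≤ 81² Σ_i |w_i|²` for `m ∈ [−1, 1]`:
`‖D_Wᴴ D_W‖ = ‖D_W‖² ≤ (|m + 4| + 4)² ≤ 81` (`l2_opNorm_wilsonDirac_le`). -/
private theorem lhr_sum_norm_sq_H_mulVec_le
    (U : GaugeConfig 4 L ↥(Matrix.specialUnitaryGroup (Fin 3) ℂ)) {m : ℝ} (hm1 : -1 ≤ m)
    (hm2 : m ≤ 1) (w : TorusSite 4 L × Fin 3 × Fin 4 → ℂ) :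
    ∑ i, ‖(((wilsonDirac (fundamentalRep (Fin 3)) U m 1)ᴴ *
        wilsonDirac (fundamentalRep (Fin 3)) U m 1) *ᵥ w) i‖ ^ 2 ≤ (81 : ℝ) ^ 2 * ∑ i, ‖w i‖ ^ 2 := by
  refine (sum_norm_sq_mulVec_le _ w).trans ?_
  have hD := l2_opNorm_wilsonDirac_le (fundamentalRep (Fin 3)) fundamentalRep_mem_unitaryGroup U m
  have hD9 : ‖wilsonDirac (fundamentalRep (Fin 3)) U m 1‖ ≤ 9 := by
    refine hD.trans ?_
    rw [abs_of_pos (by linarith)]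
    linarith
  have hH : ‖(wilsonDirac (fundamentalRep (Fin 3)) U m 1)ᴴ *
      wilsonDirac (fundamentalRep (Fin 3)) U m 1‖ ≤ 81 := by
    rw [Matrix.l2_opNorm_conjTranspose_mul_self]
    nlinarith [norm_nonneg (wilsonDirac (fundamentalRep (Fin 3)) U m 1)]
  have h0 : 0 ≤ ∑ i, ‖w i‖ ^ 2 := Finset.sum_nonneg fun i _ => by positivity
  exact mul_le_mul_of_nonneg_right (pow_le_pow_left₀ (norm_nonneg _) hH 2) h0

open scoped Matrix.Norms.L2Operator in
/-- **The local floor** (Neuberger's local bound + trace-deficit conversion; cf. the private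
`lmb_localFloor` of the sibling stub `stub_localModeBudget`): if `|m| ≥ m₀ > 0`, `m ≥ −1`, and
every site of `w` is at torus distance `> 1` from every site carrying a plaquette of deficit
`≥ ε₀`, then `(m₀² − 30√(2ε₀)) Σ‖w_p‖² ≤ Σ‖(D_W(U, m, 1) w)_p‖²`. -/
private theorem lhr_localFloor (U : GaugeConfig 4 L ↥(Matrix.specialUnitaryGroup (Fin 3) ℂ))
    {m₀ m ε₀ : ℝ} (hm₀ : 0 < m₀) (hm : -1 ≤ m) (hm₀m : m₀ ≤ |m|)
    (w : TorusSite 4 L × Fin 3 × Fin 4 → ℂ)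
    (hw : ∀ p, w p ≠ 0 → ∀ y : TorusSite 4 L,
      (∃ μ ν : Fin 4,
        ε₀ ≤ 3 - ((fundamentalRep (Fin 3) (plaquetteHolonomy U y μ ν)).trace).re) →
        1 < torusDist p.1 y) :
    (m₀ ^ 2 - 30 * Real.sqrt (2 * ε₀)) * ∑ p, ‖w p‖ ^ 2 ≤
      ∑ p, ‖(wilsonDirac (fundamentalRep (Fin 3)) U m 1 *ᵥ w) p‖ ^ 2 := by
  set δ : ℝ := Real.sqrt (2 * ε₀) with hδ_def
  have hδ : 0 ≤ δ := Real.sqrt_nonneg _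
  have hplaq : ∀ y : TorusSite 4 L,
      (∃ x : TorusSite 4 L, (∃ a α, w (x, a, α) ≠ 0) ∧ torusDist x y ≤ 1) →
        ∀ μ ν : Fin 4, μ ≠ ν →
          ‖(1 : Matrix (Fin 3) (Fin 3) ℂ) - fundamentalRep (Fin 3) (plaquetteHolonomy U y μ ν)‖ ≤
            δ := by
    rintro y ⟨x, ⟨a, α, hxa⟩, hxy⟩ μ ν _
    have hlt : 3 - ((fundamentalRep (Fin 3) (plaquetteHolonomy U y μ ν)).trace).re < ε₀ := by
      by_contra hle
      exact absurd (hw (x, a, α) hxa y ⟨μ, ν, not_lt.mp hle⟩) (not_lt.mpr hxy)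
    refine (norm_one_sub_le_sqrt_two_mul_trace_deficit _
      (fundamentalRep_mem_unitaryGroup _)).trans ?_
    refine Real.sqrt_le_sqrt ?_
    push_cast
    linarith
  have hA := wilsonDirac_normSq_mulVec_ge_of_plaquette_near_support (fundamentalRep (Fin 3))
    fundamentalRep_mem_unitaryGroup U m hm δ hδ w hplaq
  have hsum : 0 ≤ ∑ p, ‖w p‖ ^ 2 := Finset.sum_nonneg fun p _ => by positivity
  have hm2 : m₀ ^ 2 ≤ m ^ 2 := by
    rw [← sq_abs m]
    exact pow_le_pow_left₀ hm₀.le hm₀m 2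
  exact (mul_le_mul_of_nonneg_right (by linarith) hsum).trans hA

/-- **stub_lowModesHugRoughness — sub-threshold modes hug the rough plaquettes** (registered stub
of line `low-mode-quarantine`; lattice Agmon estimate): for `m₀ ∈ (0, 1]`, with
`ε₀ = 9m₀⁴/125000`, `c = 2 log(1 + m₀/960)` and an explicit `C(m₀)`, every eigenvector
`D_Wᴴ D_W v = e v` with `0 ≤ e ≤ m₀²/4` (`|m| ≥ m₀`, `m ∈ [−1/2, 1]`, any `SU(3)` field, any
`L`) satisfies `Σ_{a,α}|v(x,a,α)|² ≤ C e^{−cn} Σ|v_i|²` at every site `x` at torus distance `≥ n`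
from all `ε₀`-rough plaquettes.  Agmon's method below Neuberger's LOCAL floor
(`Literature.Analysis.Matrix.norm_sq_le_of_eigenvector_of_localFloor`,
`wilsonDirac_normSq_mulVec_ge_of_plaquette_near_support` [Neuberger2000Bounds, §Lower bound]). -/
theorem stub_lowModesHugRoughness :
    ∀ m₀ : ℝ, 0 < m₀ → m₀ ≤ 1 → ∃ ε₀ c C : ℝ, 0 < ε₀ ∧ 0 < c ∧ 0 < C ∧
      ∀ (L : ℕ) [NeZero L] (U : GaugeConfig 4 L (Matrix.specialUnitaryGroup (Fin 3) ℂ)) (m : ℝ),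
        m ∈ Set.Icc (-(1 / 2 : ℝ)) 1 → m₀ ≤ |m| →
        ∀ (v : TorusSite 4 L × Fin 3 × Fin 4 → ℂ) (e : ℝ), 0 ≤ e → e ≤ m₀ ^ 2 / 4 →
          ((wilsonDirac (fundamentalRep (Fin 3)) U m 1)ᴴ *
              wilsonDirac (fundamentalRep (Fin 3)) U m 1).mulVec v = (e : ℂ) • v →
            ∀ (x : TorusSite 4 L) (n : ℕ),
              (∀ y : TorusSite 4 L,
                (∃ μ ν : Fin 4, ε₀ ≤ 3 - ((fundamentalRep (Fin 3) (plaquetteHolonomy U y μ ν)).trace).re) →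
                  n ≤ torusDist x y) →
              ∑ a : Fin 3, ∑ α : Fin 4, ‖v (x, a, α)‖ ^ 2 ≤
                C * Real.exp (-(c * n)) * ∑ i, ‖v i‖ ^ 2 := by
  intro m₀ hm₀ _hm₀1
  -- constants depending on `m₀` only
  obtain ⟨ε₀, hε₀_def⟩ : ∃ ε₀ : ℝ, ε₀ = 9 * m₀ ^ 4 / 125000 := ⟨_, rfl⟩
  have hε₀ : 0 < ε₀ := by rw [hε₀_def]; positivity
  obtain ⟨θ, hθ_def⟩ : ∃ θ : ℝ, θ = Real.log (1 + m₀ / 960) := ⟨_, rfl⟩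
  have hθpos : 0 < θ := by rw [hθ_def]; exact Real.log_pos (by linarith)
  have hexpθ : Real.exp θ = 1 + m₀ / 960 := by rw [hθ_def, Real.exp_log (by positivity)]
  obtain ⟨γ, hγ_def⟩ : ∃ γ : ℝ, γ = m₀ ^ 2 / 5 := ⟨_, rfl⟩
  have hγ : 0 < γ := by rw [hγ_def]; positivity
  obtain ⟨C₀, hC₀_def⟩ : ∃ C₀ : ℝ, C₀ = Real.exp (θ * ((2 : ℕ) + 1)) ^ 2 *
      ((2 * (81 : ℝ) ^ 2 + 2 * (m₀ ^ 2 / 4) ^ 2) / γ ^ 2 + 1) := ⟨_, rfl⟩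
  have hC₀ : 0 < C₀ := by rw [hC₀_def]; positivity
  refine ⟨ε₀, 2 * θ, 12 * C₀, hε₀, by positivity, by positivity, ?_⟩
  intro L _ U m hm hm₀m v e he0 he hv x n hn
  -- the rough sites and the distance to them (`= n` if there is none)
  obtain ⟨Rgh, hRgh⟩ : ∃ Rgh : Finset (TorusSite 4 L), Rgh = Finset.univ.filter fun y =>
      ∃ μ ν : Fin 4, ε₀ ≤ 3 - ((fundamentalRep (Fin 3) (plaquetteHolonomy U y μ ν)).trace).re :=
    ⟨_, rfl⟩
  obtain ⟨dR, hlip, hdle, hndR⟩ : ∃ dR : TorusSite 4 L → ℕ,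
      (∀ z w : TorusSite 4 L, dR w ≤ dR z + torusDist z w) ∧
      (∀ z, ∀ y ∈ Rgh, dR z ≤ torusDist z y) ∧ n ≤ dR x := by
    rcases Rgh.eq_empty_or_nonempty with hRe | hne
    · refine ⟨fun _ => n, fun z w => Nat.le_add_right _ _, fun z y hy => ?_, le_rfl⟩
      rw [hRe] at hy
      simp at hy
    · refine ⟨fun z => Rgh.inf' hne (torusDist z), fun z w => ?_,
        fun z y hy => Finset.inf'_le _ hy, ?_⟩
      · obtain ⟨y, hy, hzy⟩ := Finset.exists_mem_eq_inf' hne (torusDist z)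
        calc Rgh.inf' hne (torusDist w) ≤ torusDist w y := Finset.inf'_le _ hy
          _ ≤ torusDist w z + torusDist z y := torusDist_triangle' w z y
          _ = Rgh.inf' hne (torusDist z) + torusDist z w := by
              rw [hzy, torusDist_comm' w z, add_comm]
      · refine Finset.le_inf' hne _ fun y hy => hn y ?_
        rw [hRgh] at hy
        exact (Finset.mem_filter.mp hy).2
  -- numbers: `η = 96(e^θ − 1) = m₀/10`, `√F = 4m₀/5`, margin `γ = m₀²/5`
  have hη : 96 * (Real.exp θ - 1) = m₀ / 10 := by rw [hexpθ]; ring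
  have hsqF : Real.sqrt (16 * m₀ ^ 2 / 25) = 4 * m₀ / 5 := by
    rw [show 16 * m₀ ^ 2 / 25 = (4 * m₀ / 5) ^ 2 by ring, Real.sqrt_sq (by positivity)]
  have hcoer : ∀ t : ℝ, Real.sqrt (16 * m₀ ^ 2 / 25) ≤ t →
      γ ≤ t ^ 2 - 2 * (96 * (Real.exp θ - 1)) * t - (96 * (Real.exp θ - 1)) ^ 2 - e := by
    intro t ht
    rw [hsqF] at ht
    rw [hη, hγ_def]
    nlinarith [mul_nonneg (sub_nonneg.mpr ht) (by linarith : (0 : ℝ) ≤ t + 3 * m₀ / 5),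
      sq_nonneg m₀]
  -- the local floor `F = 16 m₀²/25 = m₀² − 30 √(2ε₀)` at distance `≥ 2` from the rough sites
  have hδeq : Real.sqrt (2 * ε₀) = 3 * m₀ ^ 2 / 250 := by
    rw [hε₀_def, show 2 * (9 * m₀ ^ 4 / 125000) = (3 * m₀ ^ 2 / 250) ^ 2 by ring,
      Real.sqrt_sq (by positivity)]
  have hfloor : ∀ w : TorusSite 4 L × Fin 3 × Fin 4 → ℂ, (∀ p, w p ≠ 0 → 2 ≤ dR p.1) →
      16 * m₀ ^ 2 / 25 * ∑ p, ‖w p‖ ^ 2 ≤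
        ∑ p, ‖(wilsonDirac (fundamentalRep (Fin 3)) U m 1 *ᵥ w) p‖ ^ 2 := by
    intro w hw
    have hw' : ∀ p, w p ≠ 0 → ∀ y : TorusSite 4 L,
        (∃ μ ν : Fin 4,
          ε₀ ≤ 3 - ((fundamentalRep (Fin 3) (plaquetteHolonomy U y μ ν)).trace).re) →
          1 < torusDist p.1 y := by
      intro p hp y hy
      have hyR : y ∈ Rgh := by
        rw [hRgh]
        exact Finset.mem_filter.mpr ⟨Finset.mem_univ _, hy⟩
      have h1 := hdle p.1 y hyR
      have h2 := hw p hp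
      omega
    have h1 := lhr_localFloor U hm₀ (by linarith [hm.1]) hm₀m w hw'
    have hsum : 0 ≤ ∑ p, ‖w p‖ ^ 2 := Finset.sum_nonneg fun p _ => by positivity
    refine (mul_le_mul_of_nonneg_right ?_ hsum).trans h1
    rw [hδeq]
    nlinarith [sq_nonneg m₀]
  -- the crude size bound `M = 81`
  have hM : ∀ w : TorusSite 4 L × Fin 3 × Fin 4 → ℂ,
      ∑ i, ‖(((wilsonDirac (fundamentalRep (Fin 3)) U m 1)ᴴ *
        wilsonDirac (fundamentalRep (Fin 3)) U m 1) *ᵥ w) i‖ ^ 2 ≤ (81 : ℝ) ^ 2 * ∑ i, ‖w i‖ ^ 2 :=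
    fun w => lhr_sum_norm_sq_H_mulVec_le U (by linarith [hm.1]) hm.2 w
  -- the abstract Agmon estimate, index by index
  have key : ∀ k : TorusSite 4 L × Fin 3 × Fin 4, ‖v k‖ ^ 2 ≤
      Real.exp (θ * ((2 : ℕ) + 1)) ^ 2 * ((2 * (81 : ℝ) ^ 2 + 2 * e ^ 2) / γ ^ 2 + 1) *
        Real.exp (-(2 * θ * (dR k.1 : ℕ))) * ∑ i, ‖v i‖ ^ 2 := fun k =>
    Literature.Analysis.Matrix.norm_sq_le_of_eigenvector_of_localFloor
      (fun p q : TorusSite 4 L × Fin 3 × Fin 4 => torusDist p.1 q.1)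
      (fun p q => torusDist_comm' p.1 q.1) (wilsonDirac (fundamentalRep (Fin 3)) U m 1)
      (fun p q hpq => lhr_wilsonDirac_range U m p q hpq) 96 (lhr_wilsonDirac_rowSum_le U m)
      (lhr_wilsonDirac_colSum_le U m) 81 hM (fun p => dR p.1) (fun p q => hlip p.1 q.1) 2
      (16 * m₀ ^ 2 / 25) e θ γ hθpos.le hγ hfloor hcoer v hv k
  -- assembling: `C₀(e) ≤ C₀`, `e^{−2θ dR(x)} ≤ e^{−2θ n}`, twelve components at `x`
  set N : ℝ := ∑ i, ‖v i‖ ^ 2 with hN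
  have hN0 : 0 ≤ N := Finset.sum_nonneg fun i _ => by positivity
  have hC₀e : Real.exp (θ * ((2 : ℕ) + 1)) ^ 2 * ((2 * (81 : ℝ) ^ 2 + 2 * e ^ 2) / γ ^ 2 + 1) ≤
      C₀ := by
    rw [hC₀_def]
    have he2 : e ^ 2 ≤ (m₀ ^ 2 / 4) ^ 2 := pow_le_pow_left₀ he0 he 2
    have hγ2 : 0 < γ ^ 2 := by positivity
    refine mul_le_mul_of_nonneg_left (add_le_add ?_ le_rfl) (sq_nonneg _)
    exact div_le_div_of_nonneg_right (by linarith) hγ2.le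
  have hexp_le : Real.exp (-(2 * θ * (dR x : ℕ))) ≤ Real.exp (-(2 * θ * n)) := by
    refine Real.exp_le_exp.mpr ?_
    have : (n : ℝ) ≤ dR x := by exact_mod_cast hndR
    nlinarith
  have hpt : ∀ (a : Fin 3) (α : Fin 4),
      ‖v (x, a, α)‖ ^ 2 ≤ C₀ * Real.exp (-(2 * θ * n)) * N := by
    intro a α
    refine (key (x, a, α)).trans ?_
    exact mul_le_mul_of_nonneg_right
      (mul_le_mul hC₀e hexp_le (Real.exp_pos _).le hC₀.le) hN0
  calc ∑ a : Fin 3, ∑ α : Fin 4, ‖v (x, a, α)‖ ^ 2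
      ≤ ∑ _a : Fin 3, ∑ _α : Fin 4, C₀ * Real.exp (-(2 * θ * n)) * N :=
        Finset.sum_le_sum fun a _ => Finset.sum_le_sum fun α _ => hpt a α
    _ = 12 * C₀ * Real.exp (-(2 * θ * n)) * N := by
        simp only [Finset.sum_const, Finset.card_univ, Fintype.card_fin]
        ring

end Summit.QuantumFields.QCD.Cruxes.RobustYangMillsHandover.LowModeQuarantine
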